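import Summits.Parity.GeneralizedHardyLittlewood.Theses.LiouvilleMAD

/-! Strategist r1, census §5: the deciding theorem re-rooted at the FIRST node of the engine that carries no
Landau–Siegel certificate, `LambdaLiouvilleLevel` (stmt-Parity-13325; log-power savings only), type-checks against
the CURRENT `EngineToGHL` unchanged — conjuncts 4–5 only (`LevelToPairs` is landed, conjunct 5 = PairsToGHL). -/

namespace Summit.Parity.GeneralizedHardyLittlewood.Cruxes.CosetDecorrelation.StrategistR1
open Summit.Parity.GeneralizedHardyLittlewood.Theses.LiouvilleMAD

/-- `closes` re-rooted at `LambdaLiouvilleLevel`: neither MAD crux, nor the node `DilatedChowla`, nor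
`TypeIILiouville` is a hypothesis. -/
theorem closes_rerooted_level (h : LambdaLiouvilleLevel) (hEH : ElliottHalberstam) (hX : EngineToGHL) :
    GeneralizedHardyLittlewood :=
  hX.2.2.2.2 (hX.2.2.2.1 h hEH)

/-- and at `TypeIILiouville` (stmt-Parity-13322), for comparison with p1's `RerootProbe.closes_rerooted`. -/
theorem closes_rerooted_typeII (h : TypeIILiouville) (hEH : ElliottHalberstam) (hX : EngineToGHL) :
    GeneralizedHardyLittlewood :=
  hX.2.2.2.2 (hX.2.2.2.1 (hX.2.2.1 h) hEH)

end Summit.Parity.GeneralizedHardyLittlewood.Cruxes.CosetDecorrelation.StrategistR1
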